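import Summits.QuantumAdvantage.QuantumAdvantage.Theorems.SteerDialItems
import Summits.QuantumAdvantage.QuantumAdvantage.Theorems.SpreadBridge
import Summits.QuantumAdvantage.QuantumAdvantage.Theorems.SteerDialWindow
import Summits.QuantumAdvantage.AdviceFreeQNC0.AffBells23RingCondProofs
import Summits.QuantumAdvantage.QuantumAdvantage.Theorems.SpreadDialNandRing
import Summits.QuantumAdvantage.QuantumAdvantage.Theorems.SpreadDialNoShadowLemmas
import HarnessLib

/-!
# CylinderDial, part 1/4: cylinders of the victim's cube and the class-relative PIECES of 30910 `PureCover3` (support for item stmt-QuantumAdvantage-30910)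

Cell decomp-qadv, seat lens-5, generation 13 — land port of §1–§3 of the node «CylinderDial» (published under the cell's
HOME/decomp-qadv-lens-5/g13/CylinderDial.lean; record NODE-g13.md).  Prop-defs = the node's pieces/predicates only:
`CylAlgSpread3` (algebraic spread RELATIVE TO CYLINDERS `cyl F a = {y : y|_F = a|_F}`, `2|F| ≤ n`; `F = ∅` IS `SpreadDial.AlgSpread3`,
`algSpread3_of_cylAlgSpread3`), `CylLoss3`, `CylCover3`, the cylinder tameness laws `CylTame3` / `CylTameK3 K`, the class-relative
`SpreadLossK3 K` (29064 restricted to class `K`), `KCover3 K`, `KBridge3 K`, the class `Junta` and `SpreadLossJ3`, `CylTameJ3`, `JCover3`,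
`JBridge3`.  Part 2 proves the split and the bridge, part 3 tames g8's located core, part 4 hosts the rough family `Q★`.
No `sorry`, no new axioms, no instances, no notation.
-/

set_option linter.style.longLine false
set_option linter.dupNamespace false

noncomputable section
open scoped Classical

namespace Summit.QuantumAdvantage.QuantumAdvantage.Theorems.CylinderDial

open Finset
open Literature.Computability.QuantumComplexity Literature.Computability.QuantumComplexity.RingHLF
open Literature.Computability.MetaComplexity
open Summit.QuantumAdvantage.AdviceFreeQNC0
open Summit.QuantumAdvantage.QuantumAdvantage.Theses

/-! ## §1  Vocabulary: cylinders of the victim's input cube -/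

section Vocabulary
variable {n : ℕ}

/-- The CYLINDER over the frozen set `F` with frozen word `a`: all inputs agreeing with `a` on `F`
(free coordinates `Fᶜ`). -/
def cyl (F : Finset (Fin n)) (a : Fin n → Bool) : Finset (Fin n → Bool) :=
  univ.filter fun y => ∀ i ∈ F, y i = a i

/-- CylinderDialPieces helper `mem_cyl` (decomp-qadv land package; see the module docstring). -/
theorem mem_cyl {F : Finset (Fin n)} {a y : Fin n → Bool} : y ∈ cyl F a ↔ ∀ i ∈ F, y i = a i := by
  simp [cyl]

/-- the empty frozen set: the cylinder is the whole cube. -/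
theorem cyl_empty (a : Fin n → Bool) : cyl (∅ : Finset (Fin n)) a = univ := by
  ext y; simp [cyl]

/-- cylinders over the same frozen set with different CANONICAL frozen words (words vanishing off `F`)
are disjoint. -/
theorem disjoint_cyl {F : Finset (Fin n)} {a a' : Fin n → Bool}
    (ha : ∀ i, i ∉ F → a i = false) (ha' : ∀ i, i ∉ F → a' i = false) (hne : a ≠ a') :
    Disjoint (cyl F a) (cyl F a') := by
  rw [Finset.disjoint_left]
  intro y hy hy'
  apply hne
  funext i
  by_cases hi : i ∈ F
  · rw [← (mem_cyl.1 hy) i hi, ← (mem_cyl.1 hy') i hi]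
  · rw [ha i hi, ha' i hi]

end Vocabulary

/-! ## §2  The pieces -/

section Pieces

/-- **`CylAlgSpread3`** — RELATIVE ALGEBRAIC SPREAD ON CYLINDERS (the ASYMPTOTIC REGIME of the cylinder dial;
ONE modulus, ONE ring).  Some `η > 0` and `k` such that for every degree exponent `c`, all large `n`, every
`𝔽₃` strategy `P` of degree `≤ (log₂ n)^c`, EVERY frozen set `F` with `2|F| ≤ n`, EVERY frozen word `a` and every
algebraic test `ψ` of degree `≤ (log₂ n)^c` accepting `≥ (1-η)` of the cylinder `C = cyl F a`:
at least `#C / n^k` inputs of `C ∩ {ψ = 1}` lose the victim's ring game.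
`F = ∅` is `SpreadDial.AlgSpread3` verbatim (`algSpread3_of_cylAlgSpread3`). -/
def CylAlgSpread3 : Prop :=
  ∃ η : ℝ, 0 < η ∧ ∃ k : ℕ, ∀ c : ℕ, ∃ n₀ : ℕ, ∀ n ≥ n₀,
    ∀ P : Fin n → Smolensky.CubeFn (ZMod 3) n,
      (∀ i, P i ∈ Smolensky.lowDeg (ZMod 3) n ((Nat.log 2 n) ^ c)) →
      ∀ F : Finset (Fin n), 2 * F.card ≤ n → ∀ a : Fin n → Bool,
      ∀ ψ : Smolensky.CubeFn (ZMod 3) n, ψ ∈ Smolensky.lowDeg (ZMod 3) n ((Nat.log 2 n) ^ c) →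
        (1 - η) * ((cyl F a).card : ℝ) ≤ (((cyl F a).filter fun y => ψ y = 1).card : ℝ) →
        1 / (n : ℝ) ^ k * ((cyl F a).card : ℝ) ≤
          (((cyl F a).filter fun y => ψ y = 1 ∧
              ¬ RingHLF.Rel y (fun i => decide (P i y = 1))).card : ℝ)

/-- **`CylLoss3`** — the PURE cylinder rung (`ψ = 1`): polynomial loss inside EVERY cylinder with `2|F| ≤ n`
(the `p = 3` twin of the tree's `p = 2` theorems `AffBells22.walkHardAllSubcube` (per subcube, walk coordinates) and
`ringHardOddCond2` (ring coordinates, `|W| < n/2`, conditioned form)). `cylLoss3_of_cylAlgSpread3`. -/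
def CylLoss3 : Prop :=
  ∃ k : ℕ, ∀ c : ℕ, ∃ n₀ : ℕ, ∀ n ≥ n₀,
    ∀ P : Fin n → Smolensky.CubeFn (ZMod 3) n,
      (∀ i, P i ∈ Smolensky.lowDeg (ZMod 3) n ((Nat.log 2 n) ^ c)) →
      ∀ F : Finset (Fin n), 2 * F.card ≤ n → ∀ a : Fin n → Bool,
        1 / (n : ℝ) ^ k * ((cyl F a).card : ℝ) ≤
          (((cyl F a).filter fun y => ¬ RingHLF.Rel y (fun i => decide (P i y = 1))).card : ℝ)

/-- **`CylCover3`** — piece C of the node [crux · ONE MODULUS, ONE RING · UNDECIDED (test I-CYL-v1; p = 2 sibling PROVED: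
`AffBells22.walkHardAllSubcube`, `ringHardOddCond2`) · ATTACKABLE (fold/steer laws: F = ∅ is 30909 with rungs `SteerDial.levelCover3`,
`contentCover3`; constant windows `SteerDial.windowLoss_of_polyLoss3` PROVED; subcube transport à la `AffBells22.Subcube`) · NOT known to
imply 30910 / 29064 / the leaf (bc2) · outside `Literature.Barriers.QuantumAdvantage.TwoModuliDepthTwo` (no foreign system occurs)]:
granted polynomial loss (26123) and algebraic spread (the hypothesis of 30910), algebraic spread holds RELATIVE TO EVERY CYLINDER with at
most half of the victim's coordinates frozen.  Why it might fail: a frozen word trivialising the free walk on S₃ for 𝔽₃ strategies (none known;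
refuted at p = 2 for every word). -/
def CylCover3 : Prop := SpreadDial.PolyLoss3 → SpreadDial.AlgSpread3 → CylAlgSpread3

/-- **`CylTame3`** — the GENERAL cylinder tameness law (ALL foreign systems) [NOT a binder of `closes` · victim-free STRUCTURE
statement · conjecturally FALSE: candidate refuter `Q★` = ONE ring hosting NAND of parities of full-support MOD₃-tests (§7,
`exists_mod3Nand_ring`; test I-QSTAR-v1) · FALSE at |F| = 0 already for junta systems by `Theorems.spreadDial_noAlgebraicShadow3`,
PROVED for those witnesses at one frozen block (§6) · kept as the statement the instruments test and as the parent of the class-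
relative laws `CylTameK3 K` (`cylTameK3_of_cylTame3`); the node's law is the junta-restricted `CylTameJ3`].  For every target
density `1-η'` and leak exponent `i` there are `η > 0` and `j` such that, for all exponents `k, c`, some test-degree exponent `c'`
and all large `n`: every joint win event `E` of `m ≤ n^k` fixed foreign rings answered by degree-`≤ (log₂ n)^c` outputs, of
density `≥ 1-η`, admits a frozen set `F` (`2|F| ≤ n`) and a set `A` of canonical frozen words whose cylinders cover `≥ 2ⁿ/n^j`
inputs, such that on each of these cylinders `C_a` the event has an INNER ALGEBRAIC CORE: a test `ψ_a` of degree
`≤ (log₂ n)^{c'}` accepting `≥ (1-η')·#C_a` points of the cylinder and leaking at most `#C_a/n^i` points outside `E`. -/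
def CylTame3 : Prop :=
  ∀ η' : ℝ, 0 < η' → ∀ i : ℕ, ∃ η : ℝ, 0 < η ∧ ∃ j : ℕ, ∀ k c : ℕ, ∃ c' n₀ : ℕ, ∀ n ≥ n₀,
    ∀ m : ℕ, m ≤ n ^ k → ∀ w : Fin m → Fin n → Bool,
    ∀ Q : Fin m → Fin n → Smolensky.CubeFn (ZMod 3) n,
      (∀ t i, Q t i ∈ Smolensky.lowDeg (ZMod 3) n ((Nat.log 2 n) ^ c)) →
      (1 - η) * (2 : ℝ) ^ n ≤ ((univ.filter fun y : Fin n → Bool =>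
          ∀ t, RingHLF.Rel (w t) (fun i => decide (Q t i y = 1))).card : ℝ) →
      ∃ F : Finset (Fin n), 2 * F.card ≤ n ∧ ∃ A : Finset (Fin n → Bool),
        (∀ a ∈ A, ∀ i, i ∉ F → a i = false) ∧
        1 / (n : ℝ) ^ j * (2 : ℝ) ^ n ≤ ((A.biUnion (cyl F)).card : ℝ) ∧
        ∀ a ∈ A, ∃ ψ : Smolensky.CubeFn (ZMod 3) n,
          ψ ∈ Smolensky.lowDeg (ZMod 3) n ((Nat.log 2 n) ^ c') ∧
          (1 - η') * ((cyl F a).card : ℝ) ≤ (((cyl F a).filter fun y => ψ y = 1).card : ℝ) ∧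
          (((cyl F a).filter fun y => ψ y = 1 ∧
              ¬ (∀ t, RingHLF.Rel (w t) (fun i => decide (Q t i y = 1)))).card : ℝ) ≤
            1 / (n : ℝ) ^ i * ((cyl F a).card : ℝ)


/-! ### §2b  Class-relative pieces: the JUNTA SPLIT of 30910 (lens 5: base range = junta-answered systems,
asymptotic regime = all systems, bridge = `JBridge3`) -/

/-- a CLASS of foreign systems: a predicate of the degree exponent `c`, the length `n`, the number of rings `m`,
the patterns `w` and the answer functions `Q`. -/
abbrev SysClass : Type :=
  ∀ (c n m : ℕ), (Fin m → Fin n → Bool) → (Fin m → Fin n → Smolensky.CubeFn (ZMod 3) n) → Prop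

/-- the class of ALL systems. -/
def AllSys : SysClass := fun _ _ _ _ _ => True

/-- `f` depends on at most `s` coordinates. -/
def IsJunta {n : ℕ} (s : ℕ) (f : Smolensky.CubeFn (ZMod 3) n) : Prop :=
  ∃ S : Finset (Fin n), S.card ≤ s ∧ ∀ y y' : Fin n → Bool, (∀ i ∈ S, y i = y' i) → f y = f y'

/-- the class of JUNTA-ANSWERED systems: every answer function of every foreign ring depends on at most
`(log₂ n)^c` coordinates of the victim's input (`c` = the system's degree exponent).  Contains g8's located core
(answer bits = monomials `∏_j y_{τ_j}` of `r ≤ log₂ n` variables) and every block-parity / window system of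
gens 8–12; does NOT contain full-support algebraic tests (a `MOD₃` test `[Σ cᵢ yᵢ ≡ 0]` has degree 2 and support n). -/
def Junta : SysClass := fun c n _ _ Q => ∀ t i, IsJunta ((Nat.log 2 n) ^ c) (Q t i)

/-- `SpreadLoss3` (29064) RESTRICTED to the systems of class `K` (verbatim, one hypothesis `K c n m w Q` added). -/
def SpreadLossK3 (K : SysClass) : Prop :=
  ∃ η : ℝ, 0 < η ∧ ∃ k : ℕ, ∀ c : ℕ, ∃ n₀ : ℕ, ∀ n ≥ n₀,
    ∀ P : Fin n → Smolensky.CubeFn (ZMod 3) n,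
      (∀ i, P i ∈ Smolensky.lowDeg (ZMod 3) n ((Nat.log 2 n) ^ c)) →
      ∀ m : ℕ, m ≤ n ^ k → ∀ w : Fin m → Fin n → Bool,
      ∀ Q : Fin m → Fin n → Smolensky.CubeFn (ZMod 3) n,
        (∀ t i, Q t i ∈ Smolensky.lowDeg (ZMod 3) n ((Nat.log 2 n) ^ c)) → K c n m w Q →
        (1 - η) * (2 : ℝ) ^ n ≤ ((univ.filter fun y : Fin n → Bool =>
            ∀ t, RingHLF.Rel (w t) (fun i => decide (Q t i y = 1))).card : ℝ) →
        1 / (n : ℝ) ^ k * (2 : ℝ) ^ n ≤ ((univ.filter fun y : Fin n → Bool =>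
            (∀ t, RingHLF.Rel (w t) (fun i => decide (Q t i y = 1))) ∧
            ¬ RingHLF.Rel y (fun i => decide (P i y = 1))).card : ℝ)

/-- `CylTame3` RESTRICTED to the systems of class `K` (verbatim, one hypothesis `K c n m w Q` added). -/
def CylTameK3 (K : SysClass) : Prop :=
  ∀ η' : ℝ, 0 < η' → ∀ i : ℕ, ∃ η : ℝ, 0 < η ∧ ∃ j : ℕ, ∀ k c : ℕ, ∃ c' n₀ : ℕ, ∀ n ≥ n₀,
    ∀ m : ℕ, m ≤ n ^ k → ∀ w : Fin m → Fin n → Bool,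
    ∀ Q : Fin m → Fin n → Smolensky.CubeFn (ZMod 3) n,
      (∀ t i, Q t i ∈ Smolensky.lowDeg (ZMod 3) n ((Nat.log 2 n) ^ c)) → K c n m w Q →
      (1 - η) * (2 : ℝ) ^ n ≤ ((univ.filter fun y : Fin n → Bool =>
          ∀ t, RingHLF.Rel (w t) (fun i => decide (Q t i y = 1))).card : ℝ) →
      ∃ F : Finset (Fin n), 2 * F.card ≤ n ∧ ∃ A : Finset (Fin n → Bool),
        (∀ a ∈ A, ∀ i, i ∉ F → a i = false) ∧
        1 / (n : ℝ) ^ j * (2 : ℝ) ^ n ≤ ((A.biUnion (cyl F)).card : ℝ) ∧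
        ∀ a ∈ A, ∃ ψ : Smolensky.CubeFn (ZMod 3) n,
          ψ ∈ Smolensky.lowDeg (ZMod 3) n ((Nat.log 2 n) ^ c') ∧
          (1 - η') * ((cyl F a).card : ℝ) ≤ (((cyl F a).filter fun y => ψ y = 1).card : ℝ) ∧
          (((cyl F a).filter fun y => ψ y = 1 ∧
              ¬ (∀ t, RingHLF.Rel (w t) (fun i => decide (Q t i y = 1)))).card : ℝ) ≤
            1 / (n : ℝ) ^ i * ((cyl F a).card : ℝ)

/-- COVER(K): polynomial loss and algebraic spread give foreign spread against the systems of class `K`. -/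
def KCover3 (K : SysClass) : Prop := SpreadDial.PolyLoss3 → SpreadDial.AlgSpread3 → SpreadLossK3 K

/-- BRIDGE(K): foreign spread against class-`K` systems (and algebraic spread) gives foreign spread against ALL systems. -/
def KBridge3 (K : SysClass) : Prop := SpreadLossK3 K → SpreadDial.AlgSpread3 → SpreadDial.SpreadLoss3

/-- **`SpreadLossJ3`** — 29064 `SpreadLoss3` for JUNTA-ANSWERED foreign systems [intermediate · WEAKER than 29064
(restriction, `spreadLossJ3_of_spreadLoss3`) · STRONGER than 26123 `PolyLoss3` (m = 0) · not known equivalent to either]. -/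
def SpreadLossJ3 : Prop := SpreadLossK3 Junta

/-- **`CylTameJ3`** — piece R of the node: the CYLINDER TAMENESS LAW FOR JUNTA-ANSWERED SYSTEMS [law · victim-free
STRUCTURE statement about intersections of poly-many junta-answered ring events; no 𝔽₃-vs-parity correlation content ·
UNDECIDED (instrument I-CTL-v1 restricted to junta systems) · PROVED on g8's located core (§6 `nandRing_cylTame_clause`:
freeze ONE block) · plausible in general (heuristic: a junta system's ROUGH rings — those whose event is not
`n^{-i}`-approximable within degree `(log₂ n)^{c'}` — have pairwise small total support `n^{o(1)}`, freeze it all; the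
rest is `AND` of approximable events, compressed by a fixed-seed Razborov `AND`-approximator into ONE leaky core) ·
why it might fail: a dense junta system with super-logarithmically many support-DISJOINT rough rings each needing
its own frozen block AND each of support `> n^{1-o(1)}` (ruled out by the weight bound `∏|T_j| ≤ n`? — UNDECIDED) ·
the general (non-junta) law `CylTame3` is conjecturally FALSE, §7]. -/
def CylTameJ3 : Prop := CylTameK3 Junta

/-- **`JCover3`** — COVER(junta) [intermediate · WEAKER than 30910 (`jCover3_of_pureCover3`) · reduced by this node to
`CylTameJ3 ∧ CylCover3` (`jCover3_of_pieces`, bridge PROVED) · contains g8's located core, which the node TAMES]. -/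
def JCover3 : Prop := KCover3 Junta

/-- **`JBridge3`** — piece B of the node, BRIDGE(junta) [DECLARED RESIDUAL · WEAKER than 30910 (`jBridge3_of_pureCover3`,
uses tree `SteerDial.polyLoss3_of_algSpread3_item`) · EXACT complement of `JCover3` (`pureCover3_iff_jPieces`) ·
IDEA-NEEDED · inside `Literature.Barriers.QuantumAdvantage.TwoModuliDepthTwo` · LOCATED CORE (new, §7): ONE `δ₀`-ring
hosting `NAND` of `r` parities of `n^{1/r}` FULL-SUPPORT `MOD₃`-tests (`exists_mod3Nand_ring`), which defeats inner
shadows (g8), steering/tags (victim-side), cosets/orbits (no symmetry), codimension (it is ONE ring: m = 1) and every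
SOUND cylinder (coordinate / block), while the unsound generalisations of cylinders (algebraic fibres, 𝔽₂-affine fibres)
die on the VICTIM side by advice varieties (§7 docstring)]: foreign spread against junta-answered systems, together with
algebraic spread, gives foreign spread against all systems. -/
def JBridge3 : Prop := KBridge3 Junta


end Pieces

/-! ## §3  Elementary edges -/

section Edges

/-- `F = ∅`: relative algebraic spread on cylinders contains algebraic spread (the hypothesis currency of 30910). -/
theorem algSpread3_of_cylAlgSpread3 (h : CylAlgSpread3) : SpreadDial.AlgSpread3 := by
  obtain ⟨η, hη, k, hk⟩ := h
  refine ⟨η, hη, k, fun c => ?_⟩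
  obtain ⟨n₀, hn₀⟩ := hk c
  refine ⟨n₀, fun n hn P hP ψ hψ hdens => ?_⟩
  have key := hn₀ n hn P hP ∅ (by simp) (fun _ => false) ψ hψ
  rw [cyl_empty, Finset.card_univ, Fintype.card_fun, Fintype.card_bool, Fintype.card_fin] at key
  push_cast at key
  exact key hdens

/-- `ψ = 1`: relative algebraic spread on cylinders contains the pure cylinder rung. -/
theorem cylLoss3_of_cylAlgSpread3 (h : CylAlgSpread3) : CylLoss3 := by
  obtain ⟨η, hη, k, hk⟩ := h
  refine ⟨k, fun c => ?_⟩
  obtain ⟨n₀, hn₀⟩ := hk c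
  refine ⟨n₀, fun n hn P hP F hF a => ?_⟩
  have h1 : (1 : Smolensky.CubeFn (ZMod 3) n) ∈ Smolensky.lowDeg (ZMod 3) n ((Nat.log 2 n) ^ c) := by
    have := Smolensky.mono_mem_lowDeg (F := ZMod 3) (n := n) (S := ∅) (D := (Nat.log 2 n) ^ c) (by simp)
    simpa using this
  have key := hn₀ n hn P hP F hF a 1 h1
  have hfull : ((cyl F a).filter fun y : Fin n → Bool => (1 : Smolensky.CubeFn (ZMod 3) n) y = 1) = cyl F a := by
    apply Finset.filter_true_of_mem; intro y _; rfl
  rw [hfull] at key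
  have key' := key (by nlinarith [Nat.cast_nonneg (α := ℝ) (cyl F a).card])
  refine key'.trans ?_
  exact_mod_cast Finset.card_le_card (fun y hy => by
    rw [Finset.mem_filter] at hy ⊢; exact ⟨hy.1, hy.2.2⟩)

end Edges


end Summit.QuantumAdvantage.QuantumAdvantage.Theorems.CylinderDial
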